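import Summits.Parity.GeneralizedHardyLittlewood.Theorems.BeyondDiagonalBeatsQuarter.OffDiagDualBoxLedger
import Summits.Parity.GeneralizedHardyLittlewood.Theorems.BeyondDiagonalBeatsQuarter.OffDiagDualCountStrata
import HarnessLib

/-!
# Route `PrimeLevelFamEdge`, crux K_B (stmt-Parity-20343), line `diagonal_kernel_split` rev 4, plan Ω,
# worker key L3 (part 4) `OffDiagDualStrataCount`: the dual multiplicities summed over a box on EVERY stratum —
# `Σ_{|h_j| ≤ A_j} N_c(a,β;h₁,h₂) ≤ (2A₁ + gcd(a,c))·(2A₂/c + 1)` — and the trivial ledger of a box without the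
# coprimality `(a, r) = 1`

On the coprime stratum (`a` a unit mod `c = qr`) `N_c = 𝟙[h₁ unit ∧ h₁h₂ = aβ]` and L3 part 3
(`OffDiagDualBoxLedger.sum_dualBox_norm_le`) gives `bulk·(2A₁+1)(2A₂/c+1)`. In `offDiag q l m` the parameter is
`a = l/d₁ < q` and the modulus `qr`, so `g = gcd(a, qr) = gcd(a, r)` may exceed `1` when `r > 1`; prover-1's
`OffDiagDualCountStrata` (`dualCount_natCast_le_gcd`, `gcd_dvd_val_of_mul_add_eq_zero`) controls those strata
pointwise. Here the multiplicities are summed over the box by double counting over the unit `u`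
(`N_c(a,β;h) = #{u : au = −h₁, βū = −h₂}`): for each `u` the pair `(h₁,h₂)` lies in ONE residue class each
(`≤ (2A₂/c+1)` values of `h₂`), and `Σ_u #{h₁ ∈ [-A₁,A₁] : au = −h₁} = Σ_{h₁} #{u : au = −h₁} ≤ g·#{h₁ : g ∣ h₁}
≤ g(2A₁/g + 1)`:
* **`sum_dualCount_box_le`** — `Σ_{(h₁,h₂) ∈ [-A₁,A₁]×[-A₂,A₂]} N_c(a,β;h₁,h₂) ≤ (2A₁ + gcd(a,c))·(2A₂/c + 1)`;
* **`sum_dualBox_norm_le_strata`** — `Σ_{|h_j|≤A_j} ‖Φ̂_i(h/(qr))‖·N_{qr}(α,β;h) ≤ bulk·(2A₁ + gcd(α,qr))·(2A₂/(qr)+1)`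
  for ALL `α ≥ 1` (no unit hypothesis), `bulk` as in L3 part 1 with a `J`-bound on `|J₁|`.
Elementary counting; nothing about the heart. Helper (`--supports stmt-Parity-20343`); standard axioms.
«The programme SEARCHES and TYPES; no claim about Landau–Siegel zeros, Theorems 1–2 of arXiv:2211.02515 or
a repaired Margin232 until a kernel theorem says so.»
-/

noncomputable section

open Finset
open scoped Real

namespace Summit.Parity.GeneralizedHardyLittlewood.Theorems.BeyondDiagonalBeatsQuarter.OffDiag

open Literature.NumberTheory.LFunctions Literature.NumberTheory.LFunctions.KMV2000
open Literature.Analysis.FunctionSpaces (besselJ)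
open Literature.NumberTheory.Sieve.FriedlanderIwaniecPrimes (fourier2)

/-! ### §1. Counting the units `u` with `a·u = −h₁` -/

section Count

variable {c : ℕ} [NeZero c]

/-- `#{u ∈ (ℤ/c)ˣ : a·u + h₁ = 0} ≤ gcd(a,c)` (the units inject into the solutions of `a·x = −h₁`).
[folklore] -/
theorem card_units_filter_mul_add_eq_zero_le (a : ℕ) (h₁ : ZMod c) :
    ((univ : Finset (ZMod c)ˣ).filter (fun u : (ZMod c)ˣ ↦ (a : ZMod c) * (u : ZMod c) + h₁ = 0)).card ≤
      Nat.gcd a c := by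
  classical
  calc _ ≤ ((univ : Finset (ZMod c)).filter (fun x : ZMod c ↦ (a : ZMod c) * x = -h₁)).card := by
        refine Finset.card_le_card_of_injOn (fun u : (ZMod c)ˣ ↦ (u : ZMod c)) (fun u hu ↦ ?_)
          (fun u _ v _ h ↦ Units.ext h)
        rw [Finset.mem_coe, Finset.mem_filter] at hu
        rw [Finset.mem_coe, Finset.mem_filter]
        exact ⟨Finset.mem_univ _, eq_neg_of_add_eq_zero_left hu.2⟩
    _ ≤ Nat.gcd a c := card_filter_natCast_mul_eq_le_gcd a (-h₁)

/-- If some unit `u` has `a·u + h₁ = 0` with `h₁ ∈ ℤ`, then `gcd(a,c) ∣ h₁` in `ℤ`. [folklore] -/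
theorem gcd_dvd_int_of_mul_add_eq_zero {a : ℕ} {u : (ZMod c)ˣ} {h₁ : ℤ}
    (h : (a : ZMod c) * (u : ZMod c) + (h₁ : ZMod c) = 0) : ((Nat.gcd a c : ℕ) : ℤ) ∣ h₁ := by
  have hval : Nat.gcd a c ∣ ((h₁ : ZMod c)).val := gcd_dvd_val_of_mul_add_eq_zero h
  have hgc : ((Nat.gcd a c : ℕ) : ℤ) ∣ (c : ℤ) := Int.natCast_dvd_natCast.2 (Nat.gcd_dvd_right a c)
  have hv : (((h₁ : ZMod c)).val : ℤ) = h₁ % c := ZMod.val_intCast h₁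
  have h1 : ((Nat.gcd a c : ℕ) : ℤ) ∣ h₁ % c := by rw [← hv]; exact Int.natCast_dvd_natCast.2 hval
  have h2 : ((Nat.gcd a c : ℕ) : ℤ) ∣ (c : ℤ) * (h₁ / c) := hgc.mul_right _
  have := h1.add h2
  rwa [Int.emod_add_mul_ediv] at this

/-- **Counting units against an interval**: `Σ_{h₁ ∈ [-A,A]} #{u ∈ (ℤ/c)ˣ : a·u + h₁ = 0} ≤ 2A + gcd(a,c)`
(each count is `≤ g = gcd(a,c)` and vanishes unless `g ∣ h₁`; the multiples of `g` in `[-A,A]` number `≤ 2A/g + 1`).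
[folklore] -/
theorem sum_card_units_filter_le (a : ℕ) (A : ℕ) :
    ∑ h₁ ∈ Finset.Icc (-(A : ℤ)) A,
        (((univ : Finset (ZMod c)ˣ).filter
          (fun u : (ZMod c)ˣ ↦ (a : ZMod c) * (u : ZMod c) + (h₁ : ZMod c) = 0)).card : ℝ) ≤
      2 * A + Nat.gcd a c := by
  classical
  set g : ℕ := Nat.gcd a c with hg
  have hg0 : 0 < g := Nat.gcd_pos_of_pos_right a (Nat.pos_of_ne_zero (NeZero.ne c))
  haveI : NeZero g := ⟨hg0.ne'⟩
  -- pointwise: count ≤ g·𝟙[g ∣ h₁]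
  have hpt : ∀ h₁ : ℤ, (((univ : Finset (ZMod c)ˣ).filter
      (fun u : (ZMod c)ˣ ↦ (a : ZMod c) * (u : ZMod c) + (h₁ : ZMod c) = 0)).card : ℝ) ≤
      if (h₁ : ZMod g) = 0 then (g : ℝ) else 0 := by
    intro h₁
    split_ifs with hdiv
    · exact_mod_cast card_units_filter_mul_add_eq_zero_le a (h₁ : ZMod c)
    · have hempty : ((univ : Finset (ZMod c)ˣ).filter
          (fun u : (ZMod c)ˣ ↦ (a : ZMod c) * (u : ZMod c) + (h₁ : ZMod c) = 0)) = ∅ := by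
        refine Finset.filter_false_of_mem fun u _ hu ↦ hdiv ?_
        rw [ZMod.intCast_zmod_eq_zero_iff_dvd]
        exact gcd_dvd_int_of_mul_add_eq_zero hu
      rw [hempty, Finset.card_empty, Nat.cast_zero]
  have hcount := card_Icc_filter_intCast_eq_le g A 0
  calc _ ≤ ∑ h₁ ∈ Finset.Icc (-(A : ℤ)) A, (if (h₁ : ZMod g) = 0 then (g : ℝ) else 0) := Finset.sum_le_sum fun h₁ _ ↦ hpt h₁
    _ = (g : ℝ) * (((Finset.Icc (-(A : ℤ)) A).filter (fun h : ℤ ↦ (h : ZMod g) = 0)).card : ℝ) := by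
        rw [← Finset.sum_filter, Finset.sum_const, nsmul_eq_mul, mul_comm]
    _ ≤ (g : ℝ) * (2 * A / g + 1) := mul_le_mul_of_nonneg_left hcount (Nat.cast_nonneg _)
    _ = 2 * A + g := by field_simp

/-! ### §2. The multiplicities summed over a dual box -/

/-- **`Σ_{(h₁,h₂) ∈ [-A₁,A₁]×[-A₂,A₂]} N_c(a,β;h₁,h₂) ≤ (2A₁ + gcd(a,c))·(2A₂/c + 1)`** on every stratum (double
counting over the unit `u`: for fixed `u`, `h₂ ≡ −βū` is one class, `≤ 2A₂/c + 1` values; then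
`sum_card_units_filter_le`). [cite: KowalskiMichelVanderKam2000, Lemma 3.3 p. 9 — derivation] -/
theorem sum_dualCount_box_le (a : ℕ) (β : ZMod c) (A₁ A₂ : ℕ) :
    ∑ h ∈ (Finset.Icc (-(A₁ : ℤ)) A₁) ×ˢ (Finset.Icc (-(A₂ : ℤ)) A₂),
        (dualCount c (a : ZMod c) β (h.1 : ZMod c) (h.2 : ZMod c) : ℝ) ≤
      (2 * A₁ + Nat.gcd a c) * (2 * A₂ / c + 1) := by
  classical
  set I₁ := Finset.Icc (-(A₁ : ℤ)) A₁ with hI₁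
  set I₂ := Finset.Icc (-(A₂ : ℤ)) A₂ with hI₂
  -- `N(h) = Σ_u 𝟙[a u + h₁ = 0 ∧ β ū + h₂ = 0]`
  have hN : ∀ h : ℤ × ℤ, (dualCount c (a : ZMod c) β (h.1 : ZMod c) (h.2 : ZMod c) : ℝ) =
      ∑ u : (ZMod c)ˣ, (if (a : ZMod c) * (u : ZMod c) + (h.1 : ZMod c) = 0 ∧
        β * ((u⁻¹ : (ZMod c)ˣ) : ZMod c) + (h.2 : ZMod c) = 0 then (1 : ℝ) else 0) := by
    intro h
    rw [dualCount, Finset.sum_boole]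
  rw [Finset.sum_congr rfl fun h _ ↦ hN h, Finset.sum_comm]
  -- for each `u`: the box sum factors and the `h₂`-factor is a residue-class count
  have hB0 : (0 : ℝ) ≤ 2 * A₂ / c + 1 := by positivity
  have hu : ∀ u : (ZMod c)ˣ,
      ∑ h ∈ I₁ ×ˢ I₂, (if (a : ZMod c) * (u : ZMod c) + (h.1 : ZMod c) = 0 ∧
          β * ((u⁻¹ : (ZMod c)ˣ) : ZMod c) + (h.2 : ZMod c) = 0 then (1 : ℝ) else 0) ≤
        (∑ h₁ ∈ I₁, (if (a : ZMod c) * (u : ZMod c) + (h₁ : ZMod c) = 0 then (1 : ℝ) else 0)) *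
          (2 * A₂ / c + 1) := by
    intro u
    rw [Finset.sum_product]
    have hfac : ∀ h₁ ∈ I₁, ∑ h₂ ∈ I₂, (if (a : ZMod c) * (u : ZMod c) + (h₁ : ZMod c) = 0 ∧
        β * ((u⁻¹ : (ZMod c)ˣ) : ZMod c) + (h₂ : ZMod c) = 0 then (1 : ℝ) else 0) =
        (if (a : ZMod c) * (u : ZMod c) + (h₁ : ZMod c) = 0 then (1 : ℝ) else 0) *
          ∑ h₂ ∈ I₂, (if β * ((u⁻¹ : (ZMod c)ˣ) : ZMod c) + (h₂ : ZMod c) = 0 then (1 : ℝ) else 0) := by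
      intro h₁ _
      by_cases hp : (a : ZMod c) * (u : ZMod c) + (h₁ : ZMod c) = 0
      · simp [hp]
      · simp [hp]
    rw [Finset.sum_congr rfl hfac, ← Finset.sum_mul]
    refine mul_le_mul_of_nonneg_left ?_ (Finset.sum_nonneg fun _ _ ↦ by positivity)
    rw [Finset.sum_boole]
    have hcl : (I₂.filter (fun h₂ : ℤ ↦ β * ((u⁻¹ : (ZMod c)ˣ) : ZMod c) + (h₂ : ZMod c) = 0)) =
        I₂.filter (fun h₂ : ℤ ↦ (h₂ : ZMod c) = -(β * ((u⁻¹ : (ZMod c)ˣ) : ZMod c))) := by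
      refine Finset.filter_congr fun h₂ _ ↦ ?_
      constructor
      · intro h; linear_combination h
      · intro h; rw [h]; ring
    rw [hcl, hI₂]
    exact card_Icc_filter_intCast_eq_le c A₂ _
  calc ∑ u : (ZMod c)ˣ, ∑ h ∈ I₁ ×ˢ I₂, (if (a : ZMod c) * (u : ZMod c) + (h.1 : ZMod c) = 0 ∧
          β * ((u⁻¹ : (ZMod c)ˣ) : ZMod c) + (h.2 : ZMod c) = 0 then (1 : ℝ) else 0)
      ≤ ∑ u : (ZMod c)ˣ, (∑ h₁ ∈ I₁, (if (a : ZMod c) * (u : ZMod c) + (h₁ : ZMod c) = 0 then (1 : ℝ) else 0)) *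
          (2 * A₂ / c + 1) := Finset.sum_le_sum fun u _ ↦ hu u
    _ = (∑ h₁ ∈ I₁, ∑ u : (ZMod c)ˣ,
          (if (a : ZMod c) * (u : ZMod c) + (h₁ : ZMod c) = 0 then (1 : ℝ) else 0)) * (2 * A₂ / c + 1) := by
        rw [← Finset.sum_mul, Finset.sum_comm]
    _ = (∑ h₁ ∈ I₁, (((univ : Finset (ZMod c)ˣ).filter
          (fun u : (ZMod c)ˣ ↦ (a : ZMod c) * (u : ZMod c) + (h₁ : ZMod c) = 0)).card : ℝ)) *
          (2 * A₂ / c + 1) := by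
        congr 1
        exact Finset.sum_congr rfl fun h₁ _ ↦ Finset.sum_boole _ _
    _ ≤ (2 * A₁ + Nat.gcd a c) * (2 * A₂ / c + 1) :=
        mul_le_mul_of_nonneg_right (sum_card_units_filter_le a A₁) hB0

end Count

/-! ### §3. The trivial ledger of a truncated dual box on every stratum -/

section Ledger

variable {q d₁ d₂ α β r : ℕ}

/-- **The trivial ledger without the unit hypothesis.** Let `q, d₁, d₂, α, β ≥ 1`, `qr ≥ 1`, `J ≥ 0` with
`|J₁(x)| ≤ J` for `x ≥ Z/2`. Then for all `A₁, A₂`: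
`Σ_{(h₁,h₂) ∈ [-A₁,A₁]×[-A₂,A₂]} ‖Φ̂_i(h₁/(qr),h₂/(qr))‖·N_{qr}(α,β;h₁,h₂)
  ≤ bulk · (2A₁ + gcd(α,qr))·(2A₂/(qr) + 1)`, `bulk = (9/4)K₁K₂·(d₁d₂K₁K₂/4)^{−1/2}·W(d₁d₂K₁K₂/(4q̂²))·r⁻¹·J`.
[cite: KowalskiMichelVanderKam2000, (21)–(23) p. 12 and Lemma 3.3 p. 9 — derivation] -/
theorem sum_dualBox_norm_le_strata [NeZero q] [NeZero (q * r)] (hd₁ : 1 ≤ d₁) (hd₂ : 1 ≤ d₂) (hα : 1 ≤ α)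
    (hβ : 1 ≤ β) (i : ℕ × ℕ) {J : ℝ} (hJ0 : 0 ≤ J)
    (hJ : ∀ x : ℝ, 4 * π * Real.sqrt ((α : ℝ) * (β : ℝ) * ((2 : ℝ) ^ i.1 * 2 ^ i.2)) / ((q : ℝ) * r) / 2 ≤ x →
      |besselJ 1 x| ≤ J) (A₁ A₂ : ℕ) :
    ∑ h ∈ (Finset.Icc (-(A₁ : ℤ)) A₁) ×ˢ (Finset.Icc (-(A₂ : ℤ)) A₂),
        ‖fourier2 (boxWeight q d₁ d₂ α β r i) (h.1 / (q * r : ℕ)) (h.2 / (q * r : ℕ))‖ *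
          (dualCount (q * r) (α : ZMod (q * r)) (β : ZMod (q * r)) (h.1 : ZMod (q * r)) (h.2 : ZMod (q * r)) : ℝ) ≤
      (9 / 4 * ((2 : ℝ) ^ i.1 * 2 ^ i.2) *
          (((d₁ : ℝ) * d₂ * ((2 : ℝ) ^ i.1 * 2 ^ i.2) / 4) ^ (-(1 / 2 : ℝ)) *
            cutoffW ((d₁ : ℝ) * d₂ * ((2 : ℝ) ^ i.1 * 2 ^ i.2) / 4 / qhat q ^ 2) * (r : ℝ)⁻¹ * J)) *
        ((2 * A₁ + Nat.gcd α (q * r)) * (2 * A₂ / (q * r : ℕ) + 1)) := by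
  set B : ℝ := 9 / 4 * ((2 : ℝ) ^ i.1 * 2 ^ i.2) *
    (((d₁ : ℝ) * d₂ * ((2 : ℝ) ^ i.1 * 2 ^ i.2) / 4) ^ (-(1 / 2 : ℝ)) *
      cutoffW ((d₁ : ℝ) * d₂ * ((2 : ℝ) ^ i.1 * 2 ^ i.2) / 4 / qhat q ^ 2) * (r : ℝ)⁻¹ * J) with hB
  have hB0 : 0 ≤ B := by
    have := cutoffW_nonneg ((d₁ : ℝ) * d₂ * ((2 : ℝ) ^ i.1 * 2 ^ i.2) / 4 / qhat q ^ 2)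
    positivity
  have hbulk : ∀ h : ℤ × ℤ, ‖fourier2 (boxWeight q d₁ d₂ α β r i) (h.1 / (q * r : ℕ)) (h.2 / (q * r : ℕ))‖ ≤ B :=
    fun h ↦ norm_fourier2_boxWeight_le hd₁ hd₂ hα hβ i hJ0 hJ _ _
  have hcount := sum_dualCount_box_le (c := q * r) α (β : ZMod (q * r)) A₁ A₂
  calc _ ≤ ∑ h ∈ (Finset.Icc (-(A₁ : ℤ)) A₁) ×ˢ (Finset.Icc (-(A₂ : ℤ)) A₂),
          B * (dualCount (q * r) (α : ZMod (q * r)) (β : ZMod (q * r)) (h.1 : ZMod (q * r))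
            (h.2 : ZMod (q * r)) : ℝ) :=
        Finset.sum_le_sum fun h _ ↦ mul_le_mul_of_nonneg_right (hbulk h) (Nat.cast_nonneg _)
    _ = B * ∑ h ∈ (Finset.Icc (-(A₁ : ℤ)) A₁) ×ˢ (Finset.Icc (-(A₂ : ℤ)) A₂),
          (dualCount (q * r) (α : ZMod (q * r)) (β : ZMod (q * r)) (h.1 : ZMod (q * r))
            (h.2 : ZMod (q * r)) : ℝ) := by rw [Finset.mul_sum]
    _ ≤ B * ((2 * A₁ + Nat.gcd α (q * r)) * (2 * A₂ / (q * r : ℕ) + 1)) :=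
        mul_le_mul_of_nonneg_left hcount hB0

end Ledger

end Summit.Parity.GeneralizedHardyLittlewood.Theorems.BeyondDiagonalBeatsQuarter.OffDiag
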